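import Mathlib
import Literature.Computability.AlgebraicComplexity.LandsbergRessayreNormalForm
import Literature.Computability.AlgebraicComplexity.LRPencilOfMatrix
import Literature.Computability.AlgebraicComplexity.PermanentIrreducible
import Literature.Computability.AlgebraicComplexity.StandardFamilies
import Summits.ValiantsHypothesis.ValiantsHypothesis.Theorems.FreeSubtorusConfusionCoveringGradedForm
import Summits.ValiantsHypothesis.ValiantsHypothesis.Theorems.FreeSubtorusConfusionCoveringPathWeights
import Summits.ValiantsHypothesis.ValiantsHypothesis.Theorems.FreeSubtorusOrbitDimensionBoundStubWindowWeightsFlow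

/-!
# `OrbitDimensionBound` (stmt-ValiantsHypothesis-16133), rung line `quadratic_covering` — stub `stub_windowWeights`
# (degree-`δ` graded Leibniz / windowed flow: every permutation is served in every window of `δ` levels)

The line `Cruxes/OrbitDimensionBound/Lines/quadratic_covering.lean` (route `FreeSubtorus`, rung
`Degree.QuadraticShadow`, entry-degree dial `DegreeCovering δ`) reduces the covering bound for `T_Λ`-equivariant
degree-`δ` determinantal representations of `per_n` to three registered stubs; `stub_gradedLift` (p595633) and
`stub_windowCount` (p600260) are tree theorems and are wired.  This file proves the remaining, load-bearing one,

  `stub_windowWeights : Stmt.stub_windowWeights`  (VERBATIM the line's statement; no local vocabulary),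

**Statement.**  `B` an `m × m` matrix of polynomials of total degree `≤ δ` (`1 ≤ δ`) with `det B = per_n` and regular
constant part (`rank B₀ = m - 1`); weights `c : [n] × [n] → ℂˣ` without non-negative multiplicative relations; a pair
`(g, h) ∈ GL_m²` acting MONOMIAL-WISE, `g B_u = c^u B_u h` for every exponent `u` (`B_u = B.map (coeff u)`), with
`ker B₀ ⊆ E_h(γ₀)`.  Then for every `σ ∈ 𝔖_n` and every window `[a, a + δ)` (`1 ≤ a`, `a + δ ≤ n`) some row set `I`
with `a ≤ |I| < a + δ` has `E_g(γ₀ ∏_{k ∈ I} c_{k σ(k)}) ≠ 0`.  At `δ = 1` this is the tree's `stub_pathWeights`.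

**Proof (degree-`δ` graded Leibniz / windowed flow).**  (1) In bases adapted to the generalised eigenspaces of `h`
(columns, weights `α`) and `g` (rows, weights `β`) every coefficient matrix is graded: `(P B Q)_u i j ≠ 0 ⇒
β_i = c^u α_j` (`exists_gradedForm_coeff`).  (2) `det (P B Q) = det P det Q · per_n` has a non-zero coefficient at the
permutation monomial `x_σ = ∏_k x_{k σ(k)}`; generic Leibniz extraction (`exists_perm_exponents_of_coeff_det_ne_zero`)
gives `π ∈ 𝔖_m` and exponents `u_i` with `Σ_i u_i = μ_σ` and `coeff (u_i) ((P B Q) (π i) i) ≠ 0`, so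
`β_{π i} = c^{u_i} α_i`; the `u_i ≠ 0` are indicators of pairwise disjoint BLOCKS `S_i ⊆ [n]` (cells `(k, σ k)`,
`k ∈ S_i`) of size `≤ δ` (degree bound) partitioning `[n]`.  (3) Edges `α_i → β_{π i}` (`u_i ≠ 0`) with multiplier
`c^{u_i}` and block size `|S_i|` form a flow whose divergence at `w` is `dim E_g(w) - dim E_h(w)` (rows and columns of
each weight, the `u_i = 0` columns cancelling), `≥ 0` off `γ₀` and `≥ -1` at `γ₀` by regularity
(`finrank_maxGen_le_of_ker_le`, `finrank_maxGen_le_add`); acyclicity = no relations.  (4) The WINDOWED flow lemma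
(`exists_window_of_flow`): the flow is one path from `γ₀` whose prefix block-sums increase by `≤ δ`, so every window
`[a, a + δ)` contains a prefix sum `Σ_{i ∈ J} |S_i|`, and the end of the corresponding edge is the generalised eigenvalue
`γ₀ ∏_{i ∈ J} c^{u_i} = γ₀ ∏_{k ∈ I} c_{k σ k}` of `g`, `I = ⋃_{i ∈ J} S_i`.

Honest framing: ONE registered stub (the core) of a RUNG line inside one route, landed `--supports` the crux item;
after wiring, the line `quadratic_covering` is sorry-free (rung `QuadraticShadow` and the dial `∀ δ, DegreeCovering δ`
kernel-closed in the workfile); the crux `OrbitDimensionBound` (stmt-16133), route FreeSubtorus and `VP ≠ VNP` stay OPEN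
and are NOT moved by this file.  No definitions, no named facts. [cite: LandsbergRessayre2017, Thm. 2.8, §6]
[cite: Vonzurgathen1987, Thm. 3.1]
-/

open Matrix MvPolynomial Finset Module.End
open Literature.Computability.AlgebraicComplexity LRPencil

-- the mandated summit-side namespace repeats a component by design (single-problem summit)
set_option linter.dupNamespace false

namespace Summit.ValiantsHypothesis.ValiantsHypothesis.Theorems.FreeSubtorusOrbitDimensionBound.QuadraticCovering

noncomputable section

/-- The weight `c^d = ∏_p c_p^{d p}` of an exponent is multiplicative over sums of exponents. [folklore] -/
theorem prod_pow_finsetSum {τ ι : Type*} [Fintype τ] (c : τ → ℂ) (s : Finset ι) (f : ι → τ →₀ ℕ) :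
    (∏ p, c p ^ (∑ i ∈ s, f i) p) = ∏ i ∈ s, ∏ p, c p ^ (f i) p := by
  classical
  induction s using Finset.induction_on with
  | empty => simp
  | insert a s ha ih =>
    rw [prod_insert ha, ← ih, ← prod_mul_distrib]
    refine Finset.prod_congr rfl fun p _ => ?_
    rw [sum_insert ha, Finsupp.add_apply, pow_add]

open Summit.ValiantsHypothesis.ValiantsHypothesis.Theorems.FreeSubtorusConfusionCovering
  (finrank_maxGen_le_of_ker_le finrank_maxGen_le_add card_filter_perm) in
/-- **Window weights (registered stub `stub_windowWeights` of the line `quadratic_covering`, VERBATIM).**  For a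
degree-`δ` matrix `B` with `det B = per_n` and regular constant part, weights `c` without non-negative multiplicative
relations, a monomial-wise exact lift `(g, h)` (`g B_u = c^u B_u h`) with `ker B₀ ⊆ E_h(γ₀)`: every `σ ∈ 𝔖_n` is
served in every window `[a, a + δ)` of levels by a generalised eigenvalue `γ₀ ∏_{k ∈ I} c_{k σ(k)}` of `g`,
`a ≤ |I| < a + δ`.  Proof: module docstring. [cite: LandsbergRessayre2017, Thm. 2.8, §6] -/
theorem stub_windowWeights :
    ∀ (δ n m : ℕ) (B : Matrix (Fin m) (Fin m) (MvPolynomial (Fin n × Fin n) ℂ))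
    (c : Fin n × Fin n → ℂ) (g h : GL (Fin m) ℂ) (γ₀ : ℂ),
    1 ≤ δ → (∀ i j, (B i j).totalDegree ≤ δ) → B.det = perPoly (Fin n) ℂ → (constPart B).rank = m - 1 →
    (∀ p, c p ≠ 0) →
    (∀ u : Fin n × Fin n → ℕ, u ≠ 0 → (∏ p, (c p) ^ (u p)) ≠ 1) →
    (∀ u : (Fin n × Fin n) →₀ ℕ,
      (g : Matrix (Fin m) (Fin m) ℂ) * B.map (MvPolynomial.coeff u) =
        (∏ p, (c p) ^ (u p)) • (B.map (MvPolynomial.coeff u) * (h : Matrix (Fin m) (Fin m) ℂ))) →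
    LinearMap.ker (Matrix.toLin' (constPart B)) ≤
      Module.End.maxGenEigenspace (Matrix.toLin' (h : Matrix (Fin m) (Fin m) ℂ)) γ₀ →
    ∀ (σ : Equiv.Perm (Fin n)) (a : ℕ), 1 ≤ a → a + δ ≤ n →
      ∃ I : Finset (Fin n), a ≤ I.card ∧ I.card < a + δ ∧
        Module.End.maxGenEigenspace (Matrix.toLin' (g : Matrix (Fin m) (Fin m) ℂ)) (γ₀ * ∏ k ∈ I, c (k, σ k)) ≠ ⊥ := by
  intro δ n m B c g h γ₀ hδ hdeg hdet hrank hc0 hrel hgA hker σ a ha1 haδ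
  classical
  set G := Matrix.toLin' (g : Matrix (Fin m) (Fin m) ℂ) with hG
  set H := Matrix.toLin' (h : Matrix (Fin m) (Fin m) ℂ) with hH
  -- the weight of an exponent
  set w : ((Fin n × Fin n) →₀ ℕ) → ℂ := fun d => ∏ p, c p ^ d p with hw
  have hw0 : w 0 = 1 := by simp [hw]
  have hwne : ∀ d, w d ≠ 0 := fun d => Finset.prod_ne_zero_iff.2 fun p _ => pow_ne_zero _ (hc0 p)
  -- (1) graded form of all coefficient matrices
  obtain ⟨P, Q, α, β, hcoef, hβ, hα⟩ :=
    exists_gradedForm_coeff B w (g : Matrix (Fin m) (Fin m) ℂ) h (fun d => hgA d)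
  set A' := (P : Matrix (Fin m) (Fin m) ℂ).map C * B * (Q : Matrix (Fin m) (Fin m) ℂ).map C with hA'
  have hdeg' : ∀ i j, (A' i j).totalDegree ≤ δ := totalDegree_C_mul_mul_C_le _ _ B hdeg
  -- (2) the coefficient of the permutation monomial of `σ` in `det A'`
  set μ : (Fin n × Fin n) →₀ ℕ := permMonomial σ.symm with hμ
  have hμapply : ∀ k l, μ (k, l) = if l = σ k then 1 else 0 := by
    intro k l
    rw [hμ, permMonomial_apply]
    by_cases hl : l = σ k
    · rw [if_pos hl, if_pos (by rw [hl, Equiv.symm_apply_apply])]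
    · rw [if_neg hl, if_neg (fun h' => hl (by rw [← h', Equiv.apply_symm_apply]))]
  have hA'det : A'.det = C ((P : Matrix (Fin m) (Fin m) ℂ).det * (Q : Matrix (Fin m) (Fin m) ℂ).det) *
      perPoly (Fin n) ℂ := by
    have hdetP : ((P : Matrix (Fin m) (Fin m) ℂ).map (C : ℂ →+* MvPolynomial (Fin n × Fin n) ℂ)).det =
        C (P : Matrix (Fin m) (Fin m) ℂ).det := by
      rw [← RingHom.mapMatrix_apply, ← RingHom.map_det]
    have hdetQ : ((Q : Matrix (Fin m) (Fin m) ℂ).map (C : ℂ →+* MvPolynomial (Fin n × Fin n) ℂ)).det =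
        C (Q : Matrix (Fin m) (Fin m) ℂ).det := by
      rw [← RingHom.mapMatrix_apply, ← RingHom.map_det]
    rw [hA', Matrix.det_mul, Matrix.det_mul, hdetP, hdetQ, hdet, map_mul]
    ring
  have hcoefμ : coeff μ A'.det ≠ 0 := by
    rw [hA'det, coeff_C_mul, hμ, coeff_permMonomial_perPoly, mul_one]
    exact mul_ne_zero (Matrix.GeneralLinearGroup.det_ne_zero P) (Matrix.GeneralLinearGroup.det_ne_zero Q)
  -- (3) Leibniz extraction: a permutation `π` and exponents `u i` summing to `μ`
  obtain ⟨π, u, husum, hu⟩ := exists_perm_exponents_of_coeff_det_ne_zero A' μ hcoefμ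
  have hgrade : ∀ i, β (π i) = w (u i) * α i := fun i =>
    hcoef (u i) (π i) i (by rw [Matrix.map_apply]; exact hu i)
  -- (4) bookkeeping of the exponents: `u i ≤ μ`, supported on the graph of `σ`, values `≤ 1`
  have husum' : ∀ p, ∑ i, u i p = μ p := fun p => by
    rw [← Finsupp.finsetSum_apply, husum]
  have hule : ∀ i p, u i p ≤ μ p := fun i p => by
    rw [← husum' p]
    exact Finset.single_le_sum (f := fun j => u j p) (fun j _ => Nat.zero_le _) (mem_univ i)
  have huoff : ∀ i k l, l ≠ σ k → u i (k, l) = 0 := fun i k l hl => by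
    have := hule i (k, l)
    rw [hμapply, if_neg hl] at this
    exact Nat.le_zero.1 this
  -- block sizes
  set wt : Fin m → ℕ := fun i => ∑ k, u i (k, σ k) with hwt
  have hwt_deg : ∀ i, ((u i).sum fun _ e => e) = wt i := by
    intro i
    have h1 : ((u i).sum fun _ e => e) = ∑ p, u i p := Finsupp.sum_fintype _ _ (fun _ => rfl)
    rw [h1, Fintype.sum_prod_type]
    refine Finset.sum_congr rfl fun k _ => ?_
    rw [Finset.sum_eq_single (σ k)]
    · intro l _ hl; exact huoff i k l hl
    · intro h'; exact absurd (mem_univ _) h'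
  have hwtδ : ∀ i, wt i ≤ δ := fun i => by
    rw [← hwt_deg]
    exact (le_totalDegree (mem_support_iff.2 (hu i))).trans (hdeg' _ _)
  have hwi : ∀ i, w (u i) = ∏ k, c (k, σ k) ^ u i (k, σ k) := by
    intro i
    have h1 : w (u i) = ∏ p, c p ^ u i p := rfl
    rw [h1, Fintype.prod_prod_type]
    refine Finset.prod_congr rfl fun k _ => ?_
    rw [Finset.prod_eq_single (σ k)]
    · intro l _ hl; rw [huoff i k l hl, pow_zero]
    · intro h'; exact absurd (mem_univ _) h'
  -- the edge set: columns carrying a non-constant monomial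
  set E : Finset (Fin m) := univ.filter fun i => u i ≠ 0 with hE
  have hmemE : ∀ i, i ∈ E ↔ u i ≠ 0 := fun i => by
    rw [hE, mem_filter]
    exact ⟨fun h' => h'.2, fun h' => ⟨mem_univ _, h'⟩⟩
  have hwt0 : ∀ i, u i = 0 → wt i = 0 := fun i h0 => by
    have h1 : wt i = ∑ k, u i (k, σ k) := rfl
    rw [h1]
    exact Finset.sum_eq_zero fun k _ => by rw [h0]; rfl
  have hwtpos : ∀ i ∈ E, 1 ≤ wt i := by
    intro i hi
    rw [hmemE] at hi
    obtain ⟨p₀, hp₀⟩ : ∃ p₀, u i p₀ ≠ 0 := by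
      by_contra hall
      push Not at hall
      exact hi (Finsupp.ext hall)
    obtain ⟨k, l⟩ := p₀
    have hl : l = σ k := by
      by_contra hl
      exact hp₀ (huoff i k l hl)
    subst hl
    calc 1 ≤ u i (k, σ k) := Nat.one_le_iff_ne_zero.2 hp₀
      _ ≤ wt i := Finset.single_le_sum (f := fun k => u i (k, σ k)) (fun _ _ => Nat.zero_le _) (mem_univ k)
  have hoffE : ∀ i, i ∉ E → β (π i) = α i := by
    intro i hi
    rw [hmemE, not_not] at hi
    rw [hgrade i, hi, hw0, one_mul]
  -- (5) the edges `α i → β (π i)` (`i ∈ E`) with multipliers `c^{u i}` and block sizes `wt i`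
  set src : Fin m → ℂ := fun i => α i with hsrc_def
  set dst : Fin m → ℂ := fun i => β (π i) with hdst_def
  set cE : Fin m → ℂ := fun i => w (u i) with hcE_def
  have hdst' : ∀ i ∈ E, dst i = cE i * src i := fun i _ => hgrade i
  have hHinj : Function.Injective H := by
    intro x y hxy
    rw [hH, Matrix.toLin'_apply, Matrix.toLin'_apply] at hxy
    exact (Matrix.mulVec_injective_iff_isUnit.2 (Units.isUnit h)) hxy
  have hαne : ∀ j, α j ≠ 0 := by
    intro j h0
    have h1 : 1 ≤ (univ.filter fun j' => α j' = α j).card :=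
      Finset.one_le_card.2 ⟨j, mem_filter.2 ⟨mem_univ _, rfl⟩⟩
    rw [hα, h0, ← hH, maxGenEigenspace_zero_eq_bot_of_injective H hHinj, finrank_bot] at h1
    exact Nat.not_succ_le_zero 0 h1
  have hsrc' : ∀ i ∈ E, src i ≠ 0 := fun i _ => hαne i
  have hcE0 : ∀ i ∈ E, cE i ≠ 0 := fun i _ => hwne (u i)
  have hwt' : ∀ i ∈ E, 1 ≤ wt i ∧ wt i ≤ δ := fun i hi => ⟨hwtpos i hi, hwtδ i⟩
  -- (6) counting rows and columns of each weight
  have hsplit : ∀ (Pr : Fin m → Prop),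
      (univ.filter Pr).card = (E.filter Pr).card + (univ.filter fun i => Pr i ∧ i ∉ E).card := by
    intro Pr
    rw [← Finset.card_filter_add_card_filter_not (s := univ.filter Pr) (fun i => i ∈ E)]
    congr 1
    · congr 1
      ext i
      simp only [mem_filter, mem_univ, true_and]
      tauto
    · congr 1
      ext i
      simp only [mem_filter, mem_univ, true_and]
  have hrow : ∀ w', Module.finrank ℂ (Module.End.maxGenEigenspace G w') =
      (E.filter fun i => dst i = w').card + (univ.filter fun i => α i = w' ∧ i ∉ E).card := by
    intro w'
    rw [hG, ← hβ w', ← card_filter_perm π (fun i => β i = w'), hsplit (fun j => β (π j) = w')]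
    congr 1
    refine congrArg Finset.card (Finset.filter_congr fun j _ => ?_)
    constructor
    · rintro ⟨h1, h2⟩; exact ⟨(hoffE j h2) ▸ h1, h2⟩
    · rintro ⟨h1, h2⟩; exact ⟨(hoffE j h2).symm ▸ h1, h2⟩
  have hcol : ∀ w', Module.finrank ℂ (Module.End.maxGenEigenspace H w') =
      (E.filter fun i => src i = w').card + (univ.filter fun i => α i = w' ∧ i ∉ E).card := by
    intro w'
    rw [hH, ← hα w', hsplit (fun j => α j = w')]
  have hcp : constPart B = B.map (coeff 0) := by
    ext i j
    rw [constPart_apply, Matrix.map_apply, constantCoeff_eq]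
  have hgΛ : (g : Matrix (Fin m) (Fin m) ℂ) * constPart B = constPart B * (h : Matrix (Fin m) (Fin m) ℂ) := by
    have h0 := hgA 0
    have h1 : (∏ p, c p ^ ((0 : (Fin n × Fin n) →₀ ℕ) p)) = 1 := by simp
    rw [← hcp, h1, one_smul] at h0
    exact h0
  have hint : G ∘ₗ Matrix.toLin' (constPart B) = Matrix.toLin' (constPart B) ∘ₗ H := by
    rw [hG, hH, ← Matrix.toLin'_mul, hgΛ, Matrix.toLin'_mul]
  have hflowA : ∀ w', w' ≠ γ₀ →
      (E.filter fun i => src i = w').card ≤ (E.filter fun i => dst i = w').card := by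
    intro w' hw'
    have h1 := finrank_maxGen_le_of_ker_le G H (Matrix.toLin' (constPart B)) hint hker hw'
    rw [hrow w', hcol w'] at h1
    omega
  have hK : Module.finrank ℂ (LinearMap.ker (Matrix.toLin' (constPart B))) ≤ 1 := by
    have h1 := LinearMap.finrank_range_add_finrank_ker (Matrix.toLin' (constPart B))
    rw [Module.finrank_fin_fun] at h1
    have h2 : Module.finrank ℂ (LinearMap.range (Matrix.toLin' (constPart B))) = m - 1 := by
      rw [Matrix.toLin'_apply']; exact hrank
    omega
  have hflowA' : (E.filter fun i => src i = γ₀).card ≤ (E.filter fun i => dst i = γ₀).card + 1 := by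
    have h1 := finrank_maxGen_le_add G H (Matrix.toLin' (constPart B)) hint γ₀
    rw [hrow γ₀, hcol γ₀] at h1
    omega
  -- (7) no relations ⇒ no product of a non-empty sequence of edge multipliers is `1`
  have hseq : ∀ (t : ℕ) (p : ℕ → Fin m), 0 < t → (∀ s, s < t → p s ∈ E) →
      ∏ s ∈ range t, cE (p s) ≠ 1 := by
    intro t p ht hp
    have hprod : ∏ s ∈ range t, cE (p s) = w (∑ s ∈ range t, u (p s)) :=
      (prod_pow_finsetSum c (range t) (fun s => u (p s))).symm
    set U := ∑ s ∈ range t, u (p s) with hU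
    have hp0 : p 0 ∈ E := hp 0 ht
    rw [hmemE] at hp0
    obtain ⟨q₀, hq₀⟩ : ∃ q₀, u (p 0) q₀ ≠ 0 := by
      by_contra hall
      push Not at hall
      exact hp0 (Finsupp.ext hall)
    have hU0 : (⇑U : Fin n × Fin n → ℕ) ≠ 0 := by
      intro h0
      have h1 : U q₀ = 0 := by rw [h0]; rfl
      rw [hU, Finsupp.finsetSum_apply] at h1
      have h2 : u (p 0) q₀ ≤ ∑ s ∈ range t, u (p s) q₀ :=
        Finset.single_le_sum (f := fun s => u (p s) q₀) (fun _ _ => Nat.zero_le _) (mem_range.2 ht)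
      rw [h1] at h2
      exact hq₀ (Nat.le_zero.1 h2)
    rw [hprod]
    exact hrel (⇑U) hU0
  -- (8) the total block size is `n`
  have htotal : ∑ i ∈ E, wt i = n := by
    have h1 : ∑ i, wt i = n := by
      have h2 : ∑ i, wt i = ∑ i, ∑ k, u i (k, σ k) := rfl
      rw [h2, Finset.sum_comm]
      calc ∑ k, ∑ i, u i (k, σ k) = ∑ _k : Fin n, (1 : ℕ) :=
            Finset.sum_congr rfl fun k _ => by rw [husum' (k, σ k), hμapply, if_pos rfl]
        _ = n := by simp
    rw [← h1]
    exact Finset.sum_filter_of_ne fun i _ hne => fun h0 => hne (hwt0 i h0)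
  -- (9) the windowed flow: one path from `γ₀`, prefix block-sums meet the window `[a, a + δ)`
  obtain ⟨J, -, hlo, hhi, i₀, -, hi₀⟩ := exists_window_of_flow cE src dst wt δ E.card E γ₀ rfl hseq hcE0
    hdst' hsrc' hwt' hflowA hflowA' a ha1 (by rw [htotal]; omega)
  -- (10) the row set served: the union of the blocks of `J`
  set eJ : Fin n → ℕ := fun k => ∑ i ∈ J, u i (k, σ k) with heJ
  have heJ1 : ∀ k, eJ k ≤ 1 := fun k => by
    calc eJ k ≤ ∑ i, u i (k, σ k) :=
          Finset.sum_le_sum_of_subset_of_nonneg (subset_univ J) (fun _ _ _ => Nat.zero_le _)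
      _ = μ (k, σ k) := husum' _
      _ ≤ 1 := by rw [hμapply, if_pos rfl]
  set I : Finset (Fin n) := univ.filter fun k => eJ k = 1 with hI
  have hIcard : I.card = ∑ i ∈ J, wt i := by
    rw [hI, Finset.card_filter]
    calc (∑ k, if eJ k = 1 then 1 else 0) = ∑ k, eJ k :=
          Finset.sum_congr rfl fun k _ => by
            rcases Nat.le_one_iff_eq_zero_or_eq_one.1 (heJ1 k) with h0 | h1
            · rw [h0]; rfl
            · rw [h1]; rfl
      _ = ∑ k, ∑ i ∈ J, u i (k, σ k) := rfl
      _ = ∑ i ∈ J, wt i := by rw [Finset.sum_comm]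
  have hIprod : ∏ k ∈ I, c (k, σ k) = ∏ i ∈ J, cE i := by
    rw [hI, Finset.prod_filter]
    calc (∏ k, if eJ k = 1 then c (k, σ k) else 1) = ∏ k, c (k, σ k) ^ eJ k :=
          Finset.prod_congr rfl fun k _ => by
            rcases Nat.le_one_iff_eq_zero_or_eq_one.1 (heJ1 k) with h0 | h1
            · rw [h0, pow_zero, if_neg Nat.zero_ne_one]
            · rw [h1, pow_one, if_pos rfl]
      _ = ∏ k, ∏ i ∈ J, c (k, σ k) ^ u i (k, σ k) :=
          Finset.prod_congr rfl fun k _ => (Finset.prod_pow_eq_pow_sum J (fun i => u i (k, σ k)) _).symm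
      _ = ∏ i ∈ J, ∏ k, c (k, σ k) ^ u i (k, σ k) := Finset.prod_comm
      _ = ∏ i ∈ J, cE i := Finset.prod_congr rfl fun i _ => (hwi i).symm
  refine ⟨I, by rw [hIcard]; exact hlo, by rw [hIcard]; exact hhi, ?_⟩
  -- (11) the end of the edge `i₀` is a generalised eigenvalue of `g`
  have h1 : 1 ≤ (univ.filter fun i' => β i' = dst i₀).card :=
    Finset.one_le_card.2 ⟨π i₀, mem_filter.2 ⟨mem_univ _, rfl⟩⟩
  rw [hβ, hi₀, ← hIprod] at h1
  intro hbot
  rw [hbot, finrank_bot] at h1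
  exact Nat.not_succ_le_zero 0 h1

end

end Summit.ValiantsHypothesis.ValiantsHypothesis.Theorems.FreeSubtorusOrbitDimensionBound.QuadraticCovering
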